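import Literature.NumberTheory.QuadraticForms.HasseNormTheorem
import Literature.NumberTheory.QuadraticForms.UnitNormIndexHilbert90
import HarnessLib

/-!
# Hasse's norm theorem for quadratic extensions, the norm index theorem, and the uniqueness of
# quaternion algebras with given ramification (Vignéras III §3 Thm. 3.1) — unconditionally

Final assembly (namespaces `Literature.NumberTheory.QuadraticForms.OMeara65` and
`Literature.NumberTheory.Automorphic`); all declarations fully proved. With O'Meara's unit norm index
65:10 now a theorem (`unitNormIndex_holds`, `UnitNormIndexHilbert90.lean`), the reductions of
`HasseNormTheorem.lean` become unconditional:

* `two_le_normIdeles_index_holds` — **O'Meara 65:14**, the first inequality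
  `2 ≤ (J_K : P_K N_{E/K} J_E) < ∞` (named fact of `QuadraticNormIndex.lean`);
* `normIdeles_index_eq_two_holds` — **O'Meara 65:21 = Vignéras III Thm. 3.7**, the norm index
  theorem `(J_K : P_K N_{E/K} J_E) = 2` for `E = K(√a)` (named fact of `QuadraticNormIndex.lean`);
* `Literature.NumberTheory.Automorphic.hilbertSymbol_eq_one_of_forall_completions_holds` —
  **Hasse's norm theorem for quadratic extensions of number fields** (O'Meara 65:23 = Vignéras
  III Cor. 3.4, named fact of `Automorphic/QuaternionAlgebraHasse.lean`): `(a, θ)_v = 1` at every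
  place implies `(a, θ)_K = 1`;
* `Literature.NumberTheory.Automorphic.nonempty_algEquiv_of_ramifiedPlaces_eq_holds` — **Vignéras
  III §3 Thm. 3.1, uniqueness half: quaternion algebras over a number field with the same finite
  and infinite ramification are isomorphic** (named fact of `Automorphic/QuaternionAlgebraAdelic.lean`),
  by `nonempty_algEquiv_of_ramifiedPlaces_eq_of_unitNormIndex` (`HasseNormTheorem.lean`), i.e. along
  Vignéras' proof (local uniqueness II Thm. 1.1, I Cor. 2.2/2.4, III Lemme 3.6, Thm. 3.8, Cor. 3.4)
  with Cor. 3.4 obtained by O'Meara's algebraic proof of the norm index theorem (§65) instead of the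
  zeta-function argument of Vignéras III §3.

## References

* O. T. O'Meara, *Introduction to quadratic forms*, Grundlehren 117, Springer (1963), §65B
  (65:10, 65:14), §65D (65:21, 65:23).
* M.-F. Vignéras, *Arithmétique des algèbres de quaternions*, LNM 800 (1980), Ch. III §3 Thm. 3.1,
  Cor. 3.4, Thm. 3.7 (PDF pp. 65–68 of the held copy).
-/

noncomputable section

namespace Literature.NumberTheory.QuadraticForms.OMeara65

/-- **O'Meara 65:14 holds**: the first inequality `2 ≤ (J_K : P_K N_{E/K} J_E) < ∞` for every
quadratic `E = K(√a)` (the named fact `two_le_normIdeles_index K` of `QuadraticNormIndex.lean`).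
[cite: Omeara1963, §65B Prop. 65:14] -/
theorem two_le_normIdeles_index_holds (K : Type) [Field K] [NumberField K] :
    two_le_normIdeles_index K :=
  two_le_normIdeles_index_of_unitNormIndex K (unitNormIndex_holds K)

/-- **O'Meara 65:21 (norm index theorem) holds** — Vignéras III Thm. 3.7,
`[K_𝔸ˣ : Kˣ n(L_𝔸ˣ)] = 2` for a quadratic extension `L = K(√a)`: the named fact
`normIdeles_index_eq_two K` of `QuadraticNormIndex.lean`. [cite: Omeara1963, §65D Prop. 65:21] -/
theorem normIdeles_index_eq_two_holds (K : Type) [Field K] [NumberField K] :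
    normIdeles_index_eq_two K :=
  normIdeles_index_eq_two_of_unitNormIndex K (unitNormIndex_holds K)

end Literature.NumberTheory.QuadraticForms.OMeara65

namespace Literature.NumberTheory.Automorphic

universe u v

/-- **Hasse's norm theorem for quadratic extensions of number fields holds** (O'Meara 65:23;
Vignéras III §3 Cor. 3.4, *Théorème des normes dans les extensions quadratiques*), in the
Hilbert-symbol form of the named fact `hilbertSymbol_eq_one_of_forall_completions K a θ` of
`QuaternionAlgebraHasse.lean`: for `a ∉ K²`, `θ ≠ 0`, if `(a, θ)_v = 1` in every completion (finite
and infinite) then `(a, θ)_K = 1`, i.e. `θ ∈ n(K(√a))`. [cite: VignerasLNM800, Ch. III §3 Cor. 3.4] -/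
theorem hilbertSymbol_eq_one_of_forall_completions_holds (K : Type) [Field K] [NumberField K]
    (a θ : K) : hilbertSymbol_eq_one_of_forall_completions K a θ :=
  QuadraticForms.OMeara65.hilbertSymbol_eq_one_of_forall_completions_of_unitNormIndex' K
    (QuadraticForms.OMeara65.unitNormIndex_holds K) a θ

/-- **Vignéras III §3 Thm. 3.1 (uniqueness) holds: two quaternion algebras over a number field with
the same finite and infinite ramification are isomorphic** — the named fact
`nonempty_algEquiv_of_ramifiedPlaces_eq K D` of `QuaternionAlgebraAdelic.lean`, unconditionally
(via `nonempty_algEquiv_of_ramifiedPlaces_eq_of_unitNormIndex` and O'Meara 65:10,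
`QuadraticForms.OMeara65.unitNormIndex_holds`). [cite: VignerasLNM800, Ch. III §3 Thm. 3.1] -/
theorem nonempty_algEquiv_of_ramifiedPlaces_eq_holds (K : Type) [Field K] [NumberField K]
    (D : Type u) [Ring D] [Algebra K D] : nonempty_algEquiv_of_ramifiedPlaces_eq.{u, v} K D :=
  nonempty_algEquiv_of_ramifiedPlaces_eq_of_unitNormIndex K D fun L _ _ ↦
    QuadraticForms.OMeara65.unitNormIndex_holds L

end Literature.NumberTheory.Automorphic
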